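import Summits.QuantumFields.BalabanUV.Beta.NVertexLamK1Prime
import Summits.QuantumFields.BalabanUV.Beta.NVertexSectors
import Summits.QuantumFields.BalabanUV.Beta.SecondOrderUnits

/-!
# `BalabanUV.Beta.LagrangeFoldComposite` — row D1 ∕ (C1), PART 113: THE ORDER-ONE CONSISTENCY (c1) AT MEMBER 0 FOR THE COMPOSITE ONE-SHOT CHART `AN R j`, FOR ANY TABLES —
# the Λ-sector of the member-0 first-order family, read through `AN`, IS the multiplier-column vertex of `cΛ • H`:
# `dM (AN R j) N (SpureRecOf 3 N V H _ cE cVH cΛ 0) (cΛ • H) = vertexOfK (AN R j) N (SrecOf 3 N V H _ cE cVH cΛ 0)`, `N = Lc^(j+1)`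

HONEST DEPENDENCY (page 1, mandatory): continuum YM on T⁴ ⇐ BetaPertH ∧ nine spine estimates (0/9 proved); BetaPertH ⇐ (D1) ∧ (D4) ∧ CAP+tail;
G-an2-4 gates asym, D1 and NE2/3/4.  HONEST FRAMING (cell contract, verbatim): «discharging `BetaPertH` makes Bałaban's UV stability UNCONDITIONAL —
a real constructive-QFT result; it is NOT the continuum limit and NOT the Clay problem.»  ABSOLUTE RULE (cell charter, verbatim): «No internally-minted
statement may enter as a cited fact. Every hypothesis is either kernel-proved in this package or a verbatim quotation of a PUBLISHED theorem with page
reference. The manuscript(s) under audit are NOT citable for their own disputed steps — they are the thing under adjudication; programme-internal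
(2001/route/tribunal) claims are never citable.»

WHY (an2 gen 87; PART 112 `WardLocusRecursiveZeroSlot.exists_wardSide_zero_of_letters_slot` displays (c1) at member 0, `hc1 : dM (G 0) Lc (SpureRecOf … 0) (M 0) κ u =
vertexOfK (G 0) Lc (SrecOf … 0) κ u`, to match g29's vertex `dM …` with the END's `vertexOfK K N S`).  For the (0.4) literal an2 g29 proved (c1) at the symmetrised resolvents
(`LagrangeFoldSym.dM_SpureRecOf_M1Of_eq_vertexOfK_SrecOf`); for the comb chart `LagrangeFoldComb`.  For the N-system's composite chart `AN R j` the K-part is PART 28's (K1′)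
`NVertexLamK1Prime.LamN_eq_neg_AN_inr_inr` — the contracted multiplier response of the composite column is MINUS the chart's own multiplier–multiplier entry — read through
PART 14's generic Fubini `NVertexLamSectorContracted.vertexOfK_SLam_apply_contracted`; PART 28 combined them only at the record's `compH`.  THIS FILE does it for ANY bounded
coarse-bond table `Q` (§1 **`vertexOfK_AN_SLam_apply`**, **`vertexOfK_AN_SLam_eq_vertexOfM`**: `vertexOfK (AN R j) N (SLam N (lamCoeffOf (KInv N) N) Q) = vertexOfM (AN R j) N Q`),
hence (c1) at member 0 for ANY (LV) border table `V` and (LH) constraint-Hessian table `H` with the multiplier table `cΛ • H` (§2 **`dM_SpureRecOf_zero_eq_vertexOfK_SrecOf_AN`**,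
the Λ-split `SrecOf_eq_SpureRecOf_add_lam_zero` + `vertexOfK_add` + `vertexOfK_smul_family` + `vertexOfM_smul_table`), and at the record (§3 **`dM_SpureRecOf_zero_eq_VN`**:
the N-vertex `VN R P j` IS `dM (AN R j) N (SpureRecOf 3 N (compV …) (compH …) _ (cE (j+1)) (cVH (j+1)) (cΛ (j+1)) 0) (cΛ (j+1) • compH …)`; the record's own `tabs.M 0` is
`P.cM (j+1) 0 • compH …`, so its (c1)₀ is the pin `P.cM (j+1) 0 = P.cΛ (j+1)` — displayed, not chosen here).  Presentation-independent: the rooted tables are an instance of §2.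

WHAT: [folklore] `tsum` ∕ kernel bookkeeping BY NAME over PART 14 ∕ 28, an2 `NVertexSectors` bounds, leaf-10∕an2 `vertexOfK_add`; no `def`, no `def … : Prop`, nothing cited,
0 sorry.  Nothing of Bałaban's asserted, valued or discharged; 0 estimates; 0∕4 row-D1 binders; (W)_j NOT claimed; NOT (C1), NOT D1, NEVER «G-an2-4 closed», NOT BetaPertH,
NOT continuum, NOT Clay.  Row D1 ∕ (C1) OWNER «beta-an2», gen 87, 2026-08-30.  No existing file touched.
-/

noncomputable section

open scoped BigOperators
open Finset
open Literature.MathematicalPhysics.QuantumFieldTheory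
open Literature.MathematicalPhysics.QuantumFieldTheory.Balaban1983to89
open Literature.MathematicalPhysics.QuantumFieldTheory.Balaban1983to89.Beta
open AffineAveraging (Site toSite)
open ExpKernelCalculus (MKer Decays BiLoc VertexFamily comp)
open OneStepResolventKernel (Fib KInv LocStencil decays_KInv)
open OneStepKernelFamily (vertexOfK)
open InterLevelTransport (SLam cwsum cwsum_apply)
open SecondOrderResponse (colM vertexOfM dM)
open BalabanStepJets (lamCoeffOf abs_lamCoeffOf_le)
open StepJetData (wilsonA)
open Summit.QuantumFields.BalabanUV.Beta.AxialDressingRooted (one_le_of_neZero)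
open Summit.QuantumFields.BalabanUV.Beta.SpineRooted (SpureRecOf locStencil_SpureRecOf SrecOf_eq_SpureRecOf_add_lam_zero)
open Summit.QuantumFields.BalabanUV.Beta.WardLocusRecursive (SrecOf SrecOf_zero)
open Summit.QuantumFields.BalabanUV.Beta.ChartConjugationReflection (vertexOfK_add abs_le_of_locStencil)
open Summit.QuantumFields.BalabanUV.Beta.SecondOrderTransport (vertexOfK_smul_family)
open Summit.QuantumFields.BalabanUV.Beta.SecondOrderUnits (vertexOfM_smul_table)
open Summit.QuantumFields.BalabanUV.Beta.CompositeOneShotJets (compV compH compV_hV compH_hH)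
open Summit.QuantumFields.BalabanUV.Beta.CompositeOneShotJetData (Roots Pins JNat AN VN VN_eq)
open Summit.QuantumFields.BalabanUV.Beta.NVertexSectors (decays_AN bdd_of_LV bdd_SLam_of_LH JNat_S_eq_S0NOf)
open Summit.QuantumFields.BalabanUV.Beta.NVertexLamSectorContracted (vertexOfK_SLam_apply_contracted)
open Summit.QuantumFields.BalabanUV.Beta.NVertexLamK1Prime (LamN_eq_neg_AN_inr_inr)

namespace Summit.QuantumFields.BalabanUV.Beta.LagrangeFoldComposite

variable {Lc : ℕ} [NeZero Lc] (R : Roots Lc) (j : ℕ)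

/-! ## §1 The Λ-stencil of ANY bounded table, read through `AN`, is the chart's multiplier-column vertex -/

/-- [folklore] **`vertexOfK_AN_SLam_apply`** — for every uniformly bounded coarse-bond table `Q`:
`vertexOfK (AN R j) N (SLam N (lamCoeffOf (KInv N) N) Q) μ y x z a b = Σ_ν Σ'_w (AN R j) (N•w) (N•y) (inr ν) (inr μ) · Q ν w x z a b`, `N = Lc^(j+1)`
(PART 14's Fubini `vertexOfK_SLam_apply_contracted` at the decays of `AN` and `KInv N`, then PART 28's (K1′) `LamN_eq_neg_AN_inr_inr`; PART 28 did this at `Q := compH` only). -/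
theorem vertexOfK_AN_SLam_apply {Q : Fin (3 + 1) → Site (3 + 1) → MKer (3 + 1) (Fib 3)} {B : ℝ}
    (hQ : ∀ (ν : Fin (3 + 1)) (w x z : Site (3 + 1)) (a b : Fib 3), |Q ν w x z a b| ≤ B) (μ : Fin (3 + 1)) (y x z : Site (3 + 1)) (a b : Fib 3) :
    vertexOfK (AN R j) (Lc ^ (j + 1)) (SLam (Lc ^ (j + 1)) (lamCoeffOf (KInv (N := Lc ^ (j + 1)) (d := 3)) (Lc ^ (j + 1))) Q) μ y x z a b
      = ∑ ν : Fin (3 + 1), ∑' w : Site (3 + 1),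
          AN R j (((Lc ^ (j + 1) : ℕ) : ℤ) • w) (((Lc ^ (j + 1) : ℕ) : ℤ) • y) (Sum.inr ν) (Sum.inr μ) * Q ν w x z a b := by
  obtain ⟨δK, CK, hδK, -, hK⟩ := decays_AN R j
  obtain ⟨δ₀, C, hδ₀, hC, hdec⟩ := decays_KInv (N := Lc ^ (j + 1)) (d := 3)
  have hc := abs_lamCoeffOf_le (N := Lc ^ (j + 1)) hdec hC hδ₀.le
  rw [vertexOfK_SLam_apply_contracted (N := Lc ^ (j + 1)) hK hδK (fun ν w κ' u => hc ν w κ' u)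
    (mul_nonneg (mul_nonneg (by positivity) hC) (Real.exp_pos _).le) hδ₀ hQ μ y x z a b, ← Finset.sum_neg_distrib]
  refine Finset.sum_congr rfl fun ν _ => ?_
  rw [← tsum_neg]
  exact tsum_congr fun w => by rw [LamN_eq_neg_AN_inr_inr, neg_mul, neg_neg]

/-- [folklore] **`vertexOfK_AN_SLam_eq_vertexOfM` — THE K-PART OF (c1) FOR THE COMPOSITE CHART, TABLE-GENERIC**: for every uniformly bounded coarse-bond table `Q`,
`vertexOfK (AN R j) N (SLam N (lamCoeffOf (KInv N) N) Q) = vertexOfM (AN R j) N Q` (`vertexOfM` = `Σ_ν cwsum N (colM …) (Q ν)`, `colM K N μ y ν w = K (N•w) (N•y) (inr ν) (inr μ)`). -/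
theorem vertexOfK_AN_SLam_eq_vertexOfM {Q : Fin (3 + 1) → Site (3 + 1) → MKer (3 + 1) (Fib 3)} {B : ℝ}
    (hQ : ∀ (ν : Fin (3 + 1)) (w x z : Site (3 + 1)) (a b : Fib 3), |Q ν w x z a b| ≤ B) (μ : Fin (3 + 1)) (y : Site (3 + 1)) :
    vertexOfK (AN R j) (Lc ^ (j + 1)) (SLam (Lc ^ (j + 1)) (lamCoeffOf (KInv (N := Lc ^ (j + 1)) (d := 3)) (Lc ^ (j + 1))) Q) μ y
      = vertexOfM (AN R j) (Lc ^ (j + 1)) Q μ y := by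
  funext x z a b
  rw [vertexOfK_AN_SLam_apply R j hQ μ y x z a b]
  simp only [vertexOfM, cwsum_apply, colM]

/-! ## §2 (c1) at member 0 for the composite chart, any (LV)(LH) tables, multiplier table `cΛ • H` -/

/-- [folklore] **`dM_SpureRecOf_zero_eq_vertexOfK_SrecOf_AN` — (c1) AT MEMBER 0 FOR `AN R j`, TABLE-GENERIC**: for every border table `V` with (LV) and constraint-Hessian
table `H` with (LH) at blocking `N = Lc^(j+1)`, any chart family `G` in the (unused at member 0) `G`-slot, and pins `cE cVH cΛ`:
`dM (AN R j) N (SpureRecOf 3 N V H G cE cVH cΛ 0) (cΛ • H) μ y = vertexOfK (AN R j) N (SrecOf 3 N V H G cE cVH cΛ 0) μ y`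
(the Λ-split of `SrecOf … 0` + `vertexOfK_add` at the uniform bounds `bdd_of_LV`∕`bdd_SLam_of_LH` + §1 + `vertexOfK_smul_family` ∕ `vertexOfM_smul_table`). -/
theorem dM_SpureRecOf_zero_eq_vertexOfK_SrecOf_AN {V H : Fin (3 + 1) → Site (3 + 1) → MKer (3 + 1) (Fib 3)}
    (hV : ∀ δ : ℝ, 0 ≤ δ → ∃ C : ℝ, LocStencil V C δ) (hH : ∀ δ : ℝ, 0 ≤ δ → ∃ C : ℝ, VertexFamily H (Lc ^ (j + 1)) C δ)
    (G : ℕ → MKer (3 + 1) (Fib 3)) (cE cVH cΛ : ℝ) (μ : Fin (3 + 1)) (y : Site (3 + 1)) :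
    dM (AN R j) (Lc ^ (j + 1)) (SpureRecOf 3 (Lc ^ (j + 1)) V H G cE cVH cΛ 0) (cΛ • H) μ y
      = vertexOfK (AN R j) (Lc ^ (j + 1)) (SrecOf 3 (Lc ^ (j + 1)) V H G cE cVH cΛ 0) μ y := by
  -- uniform bounds: the pure member-0 table `cE • wilsonA + cVH • V` and the Λ-piece `cΛ • SLam … H`
  obtain ⟨BV, hBV⟩ := bdd_of_LV (d := 3) hV
  obtain ⟨BΛ, hBΛ⟩ := bdd_SLam_of_LH (N := Lc ^ (j + 1)) (d := 3) hH
  obtain ⟨BH, hBH⟩ : ∃ B : ℝ, ∀ (ν : Fin (3 + 1)) (w x z : Site (3 + 1)) (a b : Fib 3), |H ν w x z a b| ≤ B := by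
    obtain ⟨C, hC⟩ := hH 0 le_rfl
    exact ⟨C, fun ν w x z a b => KernelWard.bdd_of_biLoc (hC ν w) le_rfl x z a b⟩
  have hW : ∀ (κ' : Fin (3 + 1)) (u x z : Site (3 + 1)) (a b : Fib 3), |wilsonA 3 κ' u x z a b| ≤ StepJetData.wBound 3 :=
    fun κ' u x z a b => NVertexSectors.bdd_wilsonA κ' u x z a b
  set B : ℝ := max (|cE| * StepJetData.wBound 3 + |cVH| * BV) (|cΛ| * BΛ) with hB
  have hSb : ∀ (κ' : Fin (3 + 1)) (u x z : Site (3 + 1)) (a b : Fib 3), |SpureRecOf 3 (Lc ^ (j + 1)) V H G cE cVH cΛ 0 κ' u x z a b| ≤ B := by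
    intro κ' u x z a b
    refine le_trans ?_ (le_max_left _ _)
    simp only [SpineRooted.SpureRecOf_zero_level, Pi.add_apply, Pi.smul_apply, smul_eq_mul]
    refine (abs_add_le _ _).trans (add_le_add ?_ ?_)
    · rw [abs_mul]; exact mul_le_mul_of_nonneg_left (hW κ' u x z a b) (abs_nonneg _)
    · rw [abs_mul]; exact mul_le_mul_of_nonneg_left (hBV κ' u x z a b) (abs_nonneg _)
  have hΛb : ∀ (κ' : Fin (3 + 1)) (u x z : Site (3 + 1)) (a b : Fib 3),
      |(fun κ u => cΛ • SLam (Lc ^ (j + 1)) (lamCoeffOf (KInv (N := Lc ^ (j + 1)) (d := 3)) (Lc ^ (j + 1))) H κ u) κ' u x z a b| ≤ B := by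
    intro κ' u x z a b
    refine le_trans ?_ (le_max_right _ _)
    simp only [Pi.smul_apply, smul_eq_mul]
    rw [abs_mul]; exact mul_le_mul_of_nonneg_left (hBΛ κ' u x z a b) (abs_nonneg _)
  have e : SrecOf 3 (Lc ^ (j + 1)) V H G cE cVH cΛ 0 = fun κ' u' => SpureRecOf 3 (Lc ^ (j + 1)) V H G cE cVH cΛ 0 κ' u' +
      (fun κ u => cΛ • SLam (Lc ^ (j + 1)) (lamCoeffOf (KInv (N := Lc ^ (j + 1)) (d := 3)) (Lc ^ (j + 1))) H κ u) κ' u' := by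
    funext κ' u'; exact SrecOf_eq_SpureRecOf_add_lam_zero V H G cE cVH cΛ κ' u'
  rw [e, vertexOfK_add (decays_AN R j) hSb hΛb, SecondOrderResponse.dM, vertexOfK_smul_family,
    vertexOfK_AN_SLam_eq_vertexOfM R j hBH, vertexOfM_smul_table]

/-- [folklore] **the same with the multiplier table in `SymTablesOf.tabsOf`'s shape** `fun μ w => cM • H μ w` on the pin `cM = cΛ` (the member-0 weight `wM1 0 = 1`). -/
theorem dM_SpureRecOf_zero_eq_vertexOfK_SrecOf_AN_of_pin {V H : Fin (3 + 1) → Site (3 + 1) → MKer (3 + 1) (Fib 3)}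
    (hV : ∀ δ : ℝ, 0 ≤ δ → ∃ C : ℝ, LocStencil V C δ) (hH : ∀ δ : ℝ, 0 ≤ δ → ∃ C : ℝ, VertexFamily H (Lc ^ (j + 1)) C δ)
    (G : ℕ → MKer (3 + 1) (Fib 3)) (cE cVH cΛ : ℝ) {cM : ℝ} (hpin : cM = cΛ) (μ : Fin (3 + 1)) (y : Site (3 + 1)) :
    dM (AN R j) (Lc ^ (j + 1)) (SpureRecOf 3 (Lc ^ (j + 1)) V H G cE cVH cΛ 0) (fun ν w => cM • H ν w) μ y
      = vertexOfK (AN R j) (Lc ^ (j + 1)) (SrecOf 3 (Lc ^ (j + 1)) V H G cE cVH cΛ 0) μ y := by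
  rw [hpin]
  exact dM_SpureRecOf_zero_eq_vertexOfK_SrecOf_AN R j hV hH G cE cVH cΛ μ y

/-! ## §3 At the record: the N-vertex IS the Lagrangian-chart derivative with the multiplier table `cΛ (j+1) • compH` -/

/-- [folklore] **`dM_SpureRecOf_zero_eq_VN`** — at the record's sym composite tables (`compV`, `compH` at `R.r`, depth `j+1`) and pins `P`:
`dM (AN R j) N (SpureRecOf 3 N (compV R.r Lc (j+1)) (compH R.r Lc (j+1)) G (cE (j+1)) (cVH (j+1)) (cΛ (j+1)) 0) (cΛ (j+1) • compH R.r Lc (j+1)) = VN R P j`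
(`VN_eq`, `JNat_S_eq_S0NOf`, `SrecOf_zero`, §2 at `compV_hV` ∕ `compH_hH`).  The record's own `(JNat R P (j+1))`-multiplier table at member 0 is `P.cM (j+1) 0 • compH …`; its
(c1)₀ is therefore the pin `P.cM (j+1) 0 = P.cΛ (j+1)` (displayed by the consumer, not chosen here). -/
theorem dM_SpureRecOf_zero_eq_VN (P : Pins) (G : ℕ → MKer (3 + 1) (Fib 3)) :
    dM (AN R j) (Lc ^ (j + 1)) (SpureRecOf 3 (Lc ^ (j + 1)) (compV R.r Lc (j + 1)) (compH R.r Lc (j + 1)) G (P.cE (j + 1)) (P.cVH (j + 1)) (P.cΛ (j + 1)) 0)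
        (P.cΛ (j + 1) • compH R.r Lc (j + 1))
      = VN R P j := by
  funext μ y
  rw [dM_SpureRecOf_zero_eq_vertexOfK_SrecOf_AN R j (compV_hV (j + 1) (one_le_of_neZero Lc) R.hr) (compH_hH (j + 1) (one_le_of_neZero Lc) R.hr) G
    (P.cE (j + 1)) (P.cVH (j + 1)) (P.cΛ (j + 1)) μ y, VN_eq, JNat_S_eq_S0NOf, SrecOf_zero]

end Summit.QuantumFields.BalabanUV.Beta.LagrangeFoldComposite

end
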